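import Mathlib.Tactic.Linarith
import Summits.CriticalPhenomena.PercolationContinuityZ3.Theorems.PercNearOneGluingNoHeavyLowerTailSahiCTCGenFun
import HarnessLib

/-!
# `NoHeavyLowerTail` (crux stmt-CriticalPhenomena-4575), P3 lane: the ALL-LIVE CLOSED FORMS of the c = 2 certificate programme as polynomials,
# and the identities `Ñ₂ = η·G022 + E_Y·Q`, `G122 = e₁·G022 − ΠD·E_Y` behind the value-level reduction

Support file (seat `prim-l12-p3`, gen 18; `--supports stmt-CriticalPhenomena-4575`).  Memos `run/shared/lean/prim/prim-l12/FROM-prim-l12-p3-g10-ALLLIVE-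
SLICES.md` §1 (closed forms) and `…-g18-VALUE-LEVEL-REDUCTION.md` §1.2 (the identities).  Vocabulary: `…SahiCTCGenFun` (`gf`, `ind`, coefficients).

For a pair of set families `KX, KZ ⊆ 2^α` on a finite type (the simplicial complexes of the programme; down-closure is not needed for the DEFINITIONS
below) the memo g10 §1 dictionary is: `ε̄_X` = non-edges of `X` (2-sets not in `KX`), `t̄_X` = non-faces of size `≥ 3`, `ω` = common non-edges,
`η` = pairs that are non-edges of `X` or of `Z`, `E_Y` = common edges; colour-blind families by size `Π` (all), `Θ₁` (size ≤ 1), `Θ` (≤ 2), `D` (≥ 3),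
`e_k` (= k).  The ALL-LIVE CLOSED FORMS (g10 §1; there derived from the generic `(TC)`-row polynomial `Ñ₂` of g9 under the hypothesis that both
complexes contain all singletons — that derivation is NOT formalised here; in this file they are definitions):
  `Q    := Π²·ω + Θ·t̄_X·t̄_Z − (Π + D)·ε̄_X·ε̄_Z − D·(ε̄_X·t̄_Z + t̄_X·ε̄_Z)`,
  `G022 := Π·D·Θ₁ + Q`,   `G122 := e₁·Q + Π·D·(e₁·Θ₁ − e₂ + η)`,   `G222 := e₂·Q + Π·D·Θ₁·η`  (`G222 = Ñ₂` all-live).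
Proved here (as polynomial identities, `ring` after the partition of the 2-sets into `η ⊔ E_Y`):
* `gf_pairs_eq` : `e₂ = GF(η) + GF(E_Y)`;
* `G222_eq` : `G222 = GF(η)·G022 + GF(E_Y)·Q` — with `G022 ≥ 0` (a theorem of the lane, on paper) this is the decomposition 'η-surplus + Y-part'
  of memo g18 §1/§5 and, at values, the equivalence `Ñ₂(r) ≥ 0 ⟺ (V)`;
* `G122_eq` : `G122 = e₁·G022 − Π·D·GF(E_Y)`;
* `forms_erase_face`, `coeff_forms_le_erase_face` : THE FACE MOVE (M2) OF THE REDUCTION THEOREM (memo g17 §1.3) — removing a face `F ∈ K_X` of size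
  `≥ 3` changes each form by `c_F·r^F·(Θ·t̄_Z − D·ε̄_Z)`, whose coefficients are `≥ 0` by the flag lemma when `K_Z` is a down-set; hence the forms
  can only go UP coefficientwise (adding faces of size ≥ 3 lowers them: WLOG flag complexes).  The edge move (M1) and the iteration to 'flag with no
  common non-edge' are not in this file;
  The edge move (M1) is in the companion file `…SahiCTCFormsEdgeMove`.
Nothing is asserted about the crux; no positivity of the forms themselves is claimed.
-/

namespace Summit.CriticalPhenomena.PercolationContinuityZ3.Theorems.SahiCTCForms

open Finset MvPolynomial SahiCTCGenFun

variable {α : Type*} [DecidableEq α] [Fintype α]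

/-! ### The dictionary of a pair of complexes -/

/-- All subsets of the ground type of a given size profile: `{S : p #S}`. [this work] -/
def bySize (p : ℕ → Prop) [DecidablePred p] : Finset (Finset α) := univ.powerset.filter fun S => p #S

/-- Non-edges of a complex: the 2-sets not in `K` (`ε̄_K`). [this work] -/
def nonEdges (K : Finset (Finset α)) : Finset (Finset α) := univ.powerset.filter fun S => #S = 2 ∧ S ∉ K

/-- Non-faces of size `≥ 3` of a complex (`t̄_K`). [this work] -/
def bigNonFaces (K : Finset (Finset α)) : Finset (Finset α) := univ.powerset.filter fun S => 3 ≤ #S ∧ S ∉ K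

/-- Common non-edges `ω` of a pair of complexes. [this work] -/
def omega (KX KZ : Finset (Finset α)) : Finset (Finset α) := univ.powerset.filter fun S => #S = 2 ∧ S ∉ KX ∧ S ∉ KZ

/-- `η`: the 2-sets that are non-edges of `KX` or of `KZ`. [this work] -/
def eta (KX KZ : Finset (Finset α)) : Finset (Finset α) := univ.powerset.filter fun S => #S = 2 ∧ (S ∉ KX ∨ S ∉ KZ)

/-- `E_Y`: the common edges (2-sets in both complexes). [this work] -/
def commonEdges (KX KZ : Finset (Finset α)) : Finset (Finset α) := univ.powerset.filter fun S => #S = 2 ∧ S ∈ KX ∧ S ∈ KZ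

/-- The 2-sets split into `η ⊔ E_Y`. [this work] -/
theorem bySize_two_eq_eta_union (KX KZ : Finset (Finset α)) :
    (bySize (· = 2) : Finset (Finset α)) = eta KX KZ ∪ commonEdges KX KZ := by
  ext S
  simp only [bySize, eta, commonEdges, mem_filter, mem_union, mem_powerset]
  tauto

/-- `η` and `E_Y` are disjoint. [this work] -/
theorem disjoint_eta_commonEdges (KX KZ : Finset (Finset α)) : Disjoint (eta KX KZ) (commonEdges KX KZ) := by
  rw [disjoint_left]
  intro S h1 h2
  simp only [eta, commonEdges, mem_filter] at h1 h2
  tauto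

omit [Fintype α] in
/-- `GF` is additive on disjoint unions. [this work] -/
theorem gf_union {A B : Finset (Finset α)} (h : Disjoint A B) : gf (A ∪ B) = gf A + gf B := by
  unfold gf; rw [sum_union h]

/-- `e₂ = GF(η) + GF(E_Y)`. [this work] -/
theorem gf_pairs_eq (KX KZ : Finset (Finset α)) :
    gf (bySize (· = 2) : Finset (Finset α)) = gf (eta KX KZ) + gf (commonEdges KX KZ) := by
  rw [bySize_two_eq_eta_union KX KZ, gf_union (disjoint_eta_commonEdges KX KZ)]

/-! ### The all-live closed forms (memo g10 §1) -/

/-- `Π = GF(2^α)`. [this work] -/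
noncomputable def PiP : MvPolynomial α ℤ := gf (univ.powerset : Finset (Finset α))
/-- `Θ₁ = GF(sets of size ≤ 1)`. [this work] -/
noncomputable def Th1 : MvPolynomial α ℤ := gf (bySize (· ≤ 1) : Finset (Finset α))
/-- `Θ = GF(sets of size ≤ 2)`. [this work] -/
noncomputable def Th : MvPolynomial α ℤ := gf (bySize (· ≤ 2) : Finset (Finset α))
/-- `D = GF(sets of size ≥ 3)`. [this work] -/
noncomputable def Dd : MvPolynomial α ℤ := gf (bySize (3 ≤ ·) : Finset (Finset α))
/-- `e_k = GF(sets of size k)` (the k-th elementary symmetric polynomial). [this work] -/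
noncomputable def ee (k : ℕ) : MvPolynomial α ℤ := gf (bySize (· = k) : Finset (Finset α))

/-- The all-live form `Q := Π²·ω + Θ·t̄_X·t̄_Z − (Π + D)·ε̄_X·ε̄_Z − D·(ε̄_X·t̄_Z + t̄_X·ε̄_Z)` (memo g10 §1; NOT ≥ 0 by itself). [this work] -/
noncomputable def Q (KX KZ : Finset (Finset α)) : MvPolynomial α ℤ :=
  PiP ^ 2 * gf (omega KX KZ) + Th * gf (bigNonFaces KX) * gf (bigNonFaces KZ)
    - (PiP + Dd) * gf (nonEdges KX) * gf (nonEdges KZ)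
    - Dd * (gf (nonEdges KX) * gf (bigNonFaces KZ) + gf (bigNonFaces KX) * gf (nonEdges KZ))

/-- The all-live closed form `G022 := Π·D·Θ₁ + Q` (memo g10 §1; coefficientwise ≥ 0 for all-live pairs is a theorem of the lane on paper —
g11 Thm A, g14 Â₂, g9/g10 slices 3–4 — not formalised). [this work] -/
noncomputable def G022 (KX KZ : Finset (Finset α)) : MvPolynomial α ℤ := PiP * Dd * Th1 + Q KX KZ

/-- The all-live closed form `G122 := e₁·Q + Π·D·(e₁·Θ₁ − e₂ + η)` (memo g10 §1). [this work] -/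
noncomputable def G122 (KX KZ : Finset (Finset α)) : MvPolynomial α ℤ :=
  ee 1 * Q KX KZ + PiP * Dd * (ee 1 * Th1 - ee 2 + gf (eta KX KZ))

/-- The all-live closed form `G222 := e₂·Q + Π·D·Θ₁·η` of the target polynomial `Ñ₂` (memo g10 §1: `G222^AL = Ñ₂^AL`). [this work] -/
noncomputable def G222 (KX KZ : Finset (Finset α)) : MvPolynomial α ℤ := ee 2 * Q KX KZ + PiP * Dd * Th1 * gf (eta KX KZ)

/-- **`Ñ₂ = η·G022 + E_Y·Q`** (memo g18 §1.2): the target splits into the `η`-part carried by `G022` and the `E_Y`-part carried by `Q`.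
[this work] -/
theorem G222_eq (KX KZ : Finset (Finset α)) : G222 KX KZ = gf (eta KX KZ) * G022 KX KZ + gf (commonEdges KX KZ) * Q KX KZ := by
  unfold G222 G022 ee
  rw [gf_pairs_eq KX KZ]
  ring

/-- **`G122 = e₁·G022 − Π·D·E_Y`** (memo g18 §1.3). [this work] -/
theorem G122_eq (KX KZ : Finset (Finset α)) : G122 KX KZ = ee 1 * G022 KX KZ - PiP * Dd * gf (commonEdges KX KZ) := by
  unfold G122 G022 ee
  rw [gf_pairs_eq KX KZ]
  ring

/-- Consequently `Ñ₂ = e₂·G022 − Π·D·Θ₁·E_Y` as well (memo g17 §2.1: `Ñ₂ = e₂·G022 − Θ₁ΠD·Y`). [this work] -/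
theorem G222_eq' (KX KZ : Finset (Finset α)) : G222 KX KZ = ee 2 * G022 KX KZ - PiP * Dd * Th1 * gf (commonEdges KX KZ) := by
  unfold G222 G022 ee
  rw [gf_pairs_eq KX KZ]
  ring

/-! ### The reduction theorem's face move (M2) (memo g17 §1.3): removing a face of size ≥ 3 from `K_X` raises every form coefficientwise -/

/-- All non-faces of a complex (the up-set `2^α ∖ K` when `K` is a down-set). [this work] -/
def nonFaces (K : Finset (Finset α)) : Finset (Finset α) := univ.powerset.filter fun S => S ∉ K

/-- `ε̄_K` is the level 2 of the non-face family. [this work] -/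
theorem nonEdges_eq (K : Finset (Finset α)) : nonEdges K = (nonFaces K).filter fun S => #S = 2 := by
  ext S; simp only [nonEdges, nonFaces, mem_filter, mem_powerset]; tauto

/-- `t̄_K` is the part of the non-face family of size `≥ 3`. [this work] -/
theorem bigNonFaces_eq (K : Finset (Finset α)) : bigNonFaces K = (nonFaces K).filter fun S => 3 ≤ #S := by
  ext S; simp only [bigNonFaces, nonFaces, mem_filter, mem_powerset]; tauto

/-- The non-faces of a down-set form an up-set. [folklore] -/
theorem isUpperSet_nonFaces {K : Finset (Finset α)} (hK : IsLowerSet (K : Set (Finset α))) :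
    IsUpperSet ((nonFaces K : Finset (Finset α)) : Set (Finset α)) := by
  intro S T hST hS
  rw [Finset.mem_coe, nonFaces, mem_filter] at hS ⊢
  exact ⟨mem_powerset.2 (subset_univ _), fun hT => hS.2 (hK hST hT)⟩

/-- Removing a set `F` of size `≥ 3` from `K_X` does not change `ε̄_X`. [this work] -/
theorem nonEdges_erase {KX : Finset (Finset α)} {F : Finset α} (hF : 3 ≤ #F) : nonEdges (KX.erase F) = nonEdges KX := by
  ext S; simp only [nonEdges, mem_filter, mem_erase, ne_eq]
  constructor
  · rintro ⟨h1, h2, h3⟩; exact ⟨h1, h2, fun h => h3 ⟨by rintro rfl; omega, h⟩⟩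
  · rintro ⟨h1, h2, h3⟩; exact ⟨h1, h2, fun h => h3 h.2⟩

/-- Removing a face `F ∈ K_X` of size `≥ 3` adds exactly `F` to `t̄_X`. [this work] -/
theorem bigNonFaces_erase {KX : Finset (Finset α)} {F : Finset α} (hFK : F ∈ KX) (hF : 3 ≤ #F) :
    bigNonFaces (KX.erase F) = insert F (bigNonFaces KX) ∧ F ∉ bigNonFaces KX := by
  refine ⟨?_, fun h => (mem_filter.1 h).2.2 hFK⟩
  ext S; simp only [bigNonFaces, mem_filter, mem_erase, mem_insert, mem_powerset, ne_eq]
  constructor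
  · rintro ⟨h1, h2, h3⟩
    by_cases hS : S = F
    · exact Or.inl hS
    · exact Or.inr ⟨h1, h2, fun h => h3 ⟨hS, h⟩⟩
  · rintro (rfl | ⟨h1, h2, h3⟩)
    · exact ⟨subset_univ _, hF, fun h => h.1 rfl⟩
    · exact ⟨h1, h2, fun h => h3 h.2⟩

/-- Removing a set of size `≥ 3` from `K_X` does not change `ω`, `η`, `E_Y` (they consist of 2-sets). [this work] -/
theorem pairFamilies_erase {KX KZ : Finset (Finset α)} {F : Finset α} (hF : 3 ≤ #F) :
    omega (KX.erase F) KZ = omega KX KZ ∧ eta (KX.erase F) KZ = eta KX KZ ∧ commonEdges (KX.erase F) KZ = commonEdges KX KZ := by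
  have key : ∀ S : Finset α, #S = 2 → (S ∈ KX.erase F ↔ S ∈ KX) := fun S hS => by
    rw [mem_erase]; exact ⟨fun h => h.2, fun h => ⟨by rintro rfl; omega, h⟩⟩
  refine ⟨?_, ?_, ?_⟩
  · ext S; simp only [omega, mem_filter]
    constructor
    · rintro ⟨h1, h2, h3, h4⟩; exact ⟨h1, h2, fun h => h3 ((key S h2).2 h), h4⟩
    · rintro ⟨h1, h2, h3, h4⟩; exact ⟨h1, h2, fun h => h3 ((key S h2).1 h), h4⟩
  · ext S; simp only [eta, mem_filter]
    constructor
    · rintro ⟨h1, h2, h3⟩; exact ⟨h1, h2, h3.imp (fun h h' => h ((key S h2).2 h')) id⟩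
    · rintro ⟨h1, h2, h3⟩; exact ⟨h1, h2, h3.imp (fun h h' => h ((key S h2).1 h')) id⟩
  · ext S; simp only [commonEdges, mem_filter]
    constructor
    · rintro ⟨h1, h2, h3, h4⟩; exact ⟨h1, h2, (key S h2).1 h3, h4⟩
    · rintro ⟨h1, h2, h3, h4⟩; exact ⟨h1, h2, (key S h2).2 h3, h4⟩

/-- **(M2) for `Q`**: removing a face `F ∈ K_X` with `#F ≥ 3` changes `Q` by `r^F · (Θ·t̄_Z − D·ε̄_Z)`. [this work] -/
theorem Q_erase_face {KX KZ : Finset (Finset α)} {F : Finset α} (hFK : F ∈ KX) (hF : 3 ≤ #F) :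
    Q (KX.erase F) KZ = Q KX KZ + monomial (ind F) 1 * (Th * gf (bigNonFaces KZ) - Dd * gf (nonEdges KZ)) := by
  obtain ⟨h1, h2⟩ := bigNonFaces_erase hFK hF
  obtain ⟨h3, _, _⟩ := pairFamilies_erase (KZ := KZ) hF
  have hgf : gf (bigNonFaces (KX.erase F)) = gf (bigNonFaces KX) + monomial (ind F) 1 := by
    rw [h1]; unfold gf; rw [sum_insert h2, add_comm]
  unfold Q
  rw [nonEdges_erase hF, hgf, h3]
  ring

/-- **(M2) for the three forms**: `F-form(K_X ∖ {F}, K_Z) − F-form(K_X, K_Z) = c_F · r^F · (Θ·t̄_Z − D·ε̄_Z)` with `c_F = 1, e₁, e₂` for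
`G022, G122, G222` (memo g17 §1.3 (M2)). [this work] -/
theorem forms_erase_face {KX KZ : Finset (Finset α)} {F : Finset α} (hFK : F ∈ KX) (hF : 3 ≤ #F) :
    G022 (KX.erase F) KZ = G022 KX KZ + monomial (ind F) 1 * (Th * gf (bigNonFaces KZ) - Dd * gf (nonEdges KZ)) ∧
    G122 (KX.erase F) KZ = G122 KX KZ + ee 1 * monomial (ind F) 1 * (Th * gf (bigNonFaces KZ) - Dd * gf (nonEdges KZ)) ∧
    G222 (KX.erase F) KZ = G222 KX KZ + ee 2 * monomial (ind F) 1 * (Th * gf (bigNonFaces KZ) - Dd * gf (nonEdges KZ)) := by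
  obtain ⟨_, h4, _⟩ := pairFamilies_erase (KZ := KZ) hF
  refine ⟨?_, ?_, ?_⟩
  · unfold G022; rw [Q_erase_face hFK hF]; ring
  · unfold G122; rw [Q_erase_face hFK hF, h4]; ring
  · unfold G222; rw [Q_erase_face hFK hF, h4]; ring

/-- The bracket `Θ·t̄_Z − D·ε̄_Z` has nonnegative coefficients when `K_Z` is a simplicial complex (down-set): the flag lemma M2
(`SahiCTCGenFun.coeff_flagLemma`). [this work] -/
theorem coeff_flagBracket_nonneg {KZ : Finset (Finset α)} (hKZ : IsLowerSet (KZ : Set (Finset α))) (n : α →₀ ℕ) :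
    0 ≤ (Th * gf (bigNonFaces KZ) - Dd * gf (nonEdges KZ) : MvPolynomial α ℤ).coeff n := by
  unfold Th Dd bySize
  rw [bigNonFaces_eq, nonEdges_eq]
  exact coeff_flagLemma_sub_nonneg (isUpperSet_nonFaces hKZ) n

omit [DecidableEq α] [Fintype α] in
/-- Multiplying a polynomial with nonnegative coefficients by a monomial `r^F` (and by a generating function) keeps the coefficients nonnegative.
[folklore] -/
theorem coeff_monomial_mul_nonneg (F : Finset α) {P : MvPolynomial α ℤ} (hP : ∀ m, 0 ≤ P.coeff m) (n : α →₀ ℕ) :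
    0 ≤ (monomial (ind F) 1 * P).coeff n := by
  rw [coeff_monomial_mul']
  split_ifs
  · rw [one_mul]; exact hP _
  · exact le_rfl

/-- **THE FACE MOVE OF THE REDUCTION THEOREM (memo g17 §1.3 (M2))**: if `K_Z` is a simplicial complex and `F ∈ K_X` has `#F ≥ 3`, then removing
`F` from `K_X` raises `G022`, `G122` and `G222 = Ñ₂` COEFFICIENTWISE.  (Read backwards: adding a face of size ≥ 3 lowers the forms, so a proof of
their nonnegativity may assume flag complexes.) [this work] -/
theorem coeff_forms_le_erase_face {KX KZ : Finset (Finset α)} (hKZ : IsLowerSet (KZ : Set (Finset α))) {F : Finset α} (hFK : F ∈ KX)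
    (hF : 3 ≤ #F) (n : α →₀ ℕ) :
    (G022 KX KZ).coeff n ≤ (G022 (KX.erase F) KZ).coeff n ∧ (G122 KX KZ).coeff n ≤ (G122 (KX.erase F) KZ).coeff n ∧
      (G222 KX KZ).coeff n ≤ (G222 (KX.erase F) KZ).coeff n := by
  obtain ⟨h0, h1, h2⟩ := forms_erase_face (KZ := KZ) hFK hF
  have hB := coeff_flagBracket_nonneg hKZ
  have hM : ∀ m, 0 ≤ (monomial (ind F) (1 : ℤ) * (Th * gf (bigNonFaces KZ) - Dd * gf (nonEdges KZ))).coeff m :=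
    coeff_monomial_mul_nonneg F hB
  refine ⟨?_, ?_, ?_⟩
  · rw [h0, coeff_add]; linarith [hM n]
  · rw [h1, mul_assoc, coeff_add]
    have := coeff_mul_nonneg (P := ee 1) (fun m => by unfold ee; exact coeff_gf_nonneg _ m) hM n
    linarith
  · rw [h2, mul_assoc, coeff_add]
    have := coeff_mul_nonneg (P := ee 2) (fun m => by unfold ee; exact coeff_gf_nonneg _ m) hM n
    linarith

end Summit.CriticalPhenomena.PercolationContinuityZ3.Theorems.SahiCTCForms
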